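import Literature.Analysis.FluidPDE.SteadyNSLiouvilleLogWeights
import Literature.Probability.Distributions.GaussianSphereMarginal
import Mathlib.MeasureTheory.Measure.Lebesgue.VolumeOfBalls
import HarnessLib

/-!
# The planar logarithmic Riesz-potential estimate (Wang–Yang 2026, Lemma A.2)

Analysis/FluidPDE support file (theorems only, no definitions, no named facts) on the discharge
path of the named fact `Literature.Analysis.FluidPDE.wangYang2026_liouville_vorticity_log`
(`SteadyNSLiouville.lean`; W. Wang, G. Yang, arXiv:2608.06040, Theorem 1.6). After the axial
variable has been integrated out of the Biot–Savart bound, the transfer of the cylindrical decay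
of the vorticity to the velocity (Prop. 4.2, (4.16)) rests on the planar estimate of
**Lemma A.2** (p. 24): for `1 < β < 2`, `γ ≥ 0` and `Φ_{β,γ}(ρ) = ρ^{-β}[log(e+ρ)]^{-γ}`
(`ρ > 1`, zero otherwise), "`∫_{ℝ²} Φ_{β,γ}(|y'|)/|x'-y'| dy' ≤ C_{β,γ} r^{1-β}[log(e+r)]^{-γ}`"
for `r = |x'| > 2`. This file proves it (`exists_lintegral_planar_logRiesz_le`, for `γ > 0`,
`r ≥ 2`, as a bound on a lower Lebesgue integral), by a two-term pointwise majorant in place of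
the printed three-region split `D₁, D₂, D₃`:
`Φ(|y'|)/|x'-y'| ≤ 2Φ(|y'|)/max(r,|y'|) + Φ*(r) 1_{B(x',3r)}(y')/|x'-y'|` with
`Φ*(r) = 2^{β+γ} r^{-β} L(r)^{-γ} ≥ sup_{r/2<ρ<2r} Φ` (`indicator_mul_inv_norm_sub_le`); the
first term is radial and is integrated in polar coordinates (the tree's
`Literature.Probability.Distributions.lintegral_fun_norm_addHaar`) with the one-dimensional
bounds of `SteadyNSLiouvilleLogWeights` (regions `D₁`, `D₃`), the second over a disc
(`lintegral_ball_inv_norm_le`: `∫_{B(0,R)} |w|⁻¹ dw = 2|B₁|R`, region `D₂`).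

## References

* W. Wang, G. Yang, *New decay estimates and Liouville type theorems for the 3D axisymmetric
  stationary Navier–Stokes equations*, arXiv:2608.06040 (2026), Lemma A.2 and the proof of
  Lemma A.1, pp. 22–24. [WangYang2026]
-/

noncomputable section

open Real Set MeasureTheory Metric Filter
open scoped ENNReal NNReal Topology

namespace Literature.Analysis.FluidPDE

/-! ### Radial integration and the inverse distance on discs -/

/-- **Polar coordinates in the plane**, `ℝ≥0∞` form: `∫ f(|w|) dw = 2|B₁| ∫₀^∞ y f(y) dy`
(the tree's `lintegral_fun_norm_addHaar` in dimension `2`). [folklore] -/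
theorem lintegral_norm_eq_two_mul (f : ℝ → ℝ≥0∞) (hf : Measurable f) :
    ∫⁻ w : EuclideanSpace ℝ (Fin 2), f ‖w‖ =
      2 * volume (ball (0 : EuclideanSpace ℝ (Fin 2)) 1) *
        ∫⁻ y in Ioi (0 : ℝ), ENNReal.ofReal y * f y := by
  rw [Literature.Probability.Distributions.lintegral_fun_norm_addHaar volume f hf,
    finrank_euclideanSpace_fin]
  simp only [Nat.cast_ofNat, Nat.add_one_sub_one, pow_one]

/-- Translation of disc integrals: `∫⁻_{B(x,R)} g(x - y) dy = ∫⁻_{B(0,R)} g(z) dz`. [folklore] -/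
theorem lintegral_ball_comp_sub_left_two (g : EuclideanSpace ℝ (Fin 2) → ℝ≥0∞)
    (x : EuclideanSpace ℝ (Fin 2)) (R : ℝ) :
    ∫⁻ y in ball x R, g (x - y) = ∫⁻ z in ball (0 : EuclideanSpace ℝ (Fin 2)) R, g z := by
  rw [← lintegral_indicator measurableSet_ball, ← lintegral_indicator measurableSet_ball,
    ← lintegral_sub_left_eq_self (fun z => (ball (0 : EuclideanSpace ℝ (Fin 2)) R).indicator g z) x]
  congr 1
  funext y
  by_cases hy : y ∈ ball x R
  · have : x - y ∈ ball (0 : EuclideanSpace ℝ (Fin 2)) R := by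
      rw [mem_ball_zero_iff, ← dist_eq_norm, dist_comm]; exact hy
    rw [indicator_of_mem hy, indicator_of_mem this]
  · have : x - y ∉ ball (0 : EuclideanSpace ℝ (Fin 2)) R := by
      rw [mem_ball_zero_iff, ← dist_eq_norm, dist_comm]; exact hy
    rw [indicator_of_notMem hy, indicator_of_notMem this]

/-- **The inverse distance on a disc**: `∫_{B(0,R)} |w|⁻¹ dw ≤ 2|B₁| R` (`= 2π R`; polar
coordinates, `y · y⁻¹ = 1` on `(0, R)`). [folklore] -/
theorem lintegral_ball_inv_norm_le (R : ℝ) :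
    ∫⁻ z in ball (0 : EuclideanSpace ℝ (Fin 2)) R, ENNReal.ofReal ‖z‖⁻¹ ≤
      2 * volume (ball (0 : EuclideanSpace ℝ (Fin 2)) 1) * ENNReal.ofReal R := by
  set F : ℝ → ℝ≥0∞ := (Iio R).indicator fun y => ENNReal.ofReal y⁻¹ with hF
  have hFm : Measurable F :=
    (ENNReal.measurable_ofReal.comp measurable_inv).indicator measurableSet_Iio
  have h1 : ∫⁻ z in ball (0 : EuclideanSpace ℝ (Fin 2)) R, ENNReal.ofReal ‖z‖⁻¹ =
      ∫⁻ z : EuclideanSpace ℝ (Fin 2), F ‖z‖ := by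
    rw [← lintegral_indicator measurableSet_ball]
    congr 1
    funext z
    by_cases hz : z ∈ ball (0 : EuclideanSpace ℝ (Fin 2)) R
    · have : ‖z‖ ∈ Iio R := by simpa using hz
      rw [indicator_of_mem hz, hF, indicator_of_mem this]
    · have : ‖z‖ ∉ Iio R := by simpa using hz
      rw [indicator_of_notMem hz, hF, indicator_of_notMem this]
  have hpt : ∀ y ∈ Ioi (0 : ℝ), ENNReal.ofReal y * F y ≤ (Iio R).indicator 1 y := by
    intro y hy
    by_cases hyR : y ∈ Iio R
    · rw [hF, indicator_of_mem hyR, indicator_of_mem hyR, Pi.one_apply,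
        ← ENNReal.ofReal_mul hy.le, mul_inv_cancel₀ (ne_of_gt hy), ENNReal.ofReal_one]
    · rw [hF, indicator_of_notMem hyR, indicator_of_notMem hyR, mul_zero]
  rw [h1, lintegral_norm_eq_two_mul F hFm]
  gcongr
  calc ∫⁻ y in Ioi (0 : ℝ), ENNReal.ofReal y * F y ≤ ∫⁻ y in Ioi (0 : ℝ), (Iio R).indicator 1 y :=
        setLIntegral_mono' measurableSet_Ioi hpt
    _ = ENNReal.ofReal R := by
        rw [lintegral_indicator_one measurableSet_Iio, Measure.restrict_apply measurableSet_Iio,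
          Iio_inter_Ioi, Real.volume_Ioo, sub_zero]

/-! ### The pointwise two-term majorant -/

/-- The profile `Φ(ρ) = (ρ^β L(ρ)^γ)⁻¹` on `(r/2, 2r)` is at most
`Φ*(r) = 2^β 2^γ (r^β L(r)^γ)⁻¹` (monotonicity and the doubling bound `L(2ρ) ≤ 2L(ρ)`).
[folklore] -/
theorem inv_rpow_mul_log_rpow_le_of_half_le {β γ r ρ : ℝ} (hβ : 0 ≤ β) (hγ : 0 ≤ γ) (hr : 0 < r)
    (hρ : r ≤ 2 * ρ) :
    (ρ ^ β * log (exp 1 + ρ) ^ γ)⁻¹ ≤ 2 ^ β * 2 ^ γ / (r ^ β * log (exp 1 + r) ^ γ) := by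
  have hρ0 : 0 < ρ := by linarith
  have hLρ : 0 < log (exp 1 + ρ) := log_exp_one_add_pos hρ0.le
  have hLr : 0 < log (exp 1 + r) := log_exp_one_add_pos hr.le
  -- `r^β ≤ (2ρ)^β`, `L(r)^γ ≤ (2 L(ρ))^γ`
  have h1 : r ^ β ≤ (2 * ρ) ^ β := rpow_le_rpow hr.le hρ hβ
  have h2 : log (exp 1 + r) ^ γ ≤ (2 * log (exp 1 + ρ)) ^ γ := by
    refine rpow_le_rpow hLr.le ((log_exp_one_add_mono hr.le hρ).trans ?_) hγ
    have h := log_exp_one_add_le_two_mul_half (by positivity : (0 : ℝ) ≤ 2 * ρ)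
    rwa [mul_div_cancel_left₀ ρ two_ne_zero] at h
  rw [inv_eq_one_div, div_le_div_iff₀ (by positivity) (by positivity), one_mul]
  calc r ^ β * log (exp 1 + r) ^ γ ≤ (2 * ρ) ^ β * (2 * log (exp 1 + ρ)) ^ γ :=
        mul_le_mul h1 h2 (by positivity) (by positivity)
    _ = 2 ^ β * 2 ^ γ * (ρ ^ β * log (exp 1 + ρ) ^ γ) := by
        rw [mul_rpow zero_le_two hρ0.le, mul_rpow zero_le_two hLρ.le]; ring

/-- **The two-term pointwise majorant** replacing the three regions of Wang–Yang's proof of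
Lemma A.2: for `r = |x'| > 0` and every `y'`,
`Φ(|y'|)/|x'-y'| ≤ 2Φ(|y'|)/max(r,|y'|) + Φ*(r) 1_{B(x',3r)}(y')/|x'-y'|`
(`Φ = 1_{(1,∞)}(ρ)(ρ^βL(ρ)^γ)⁻¹`, `Φ*(r) = 2^β2^γ(r^βL(r)^γ)⁻¹`): either
`max(r,|y'|) ≤ 2|x'-y'|`, or else `r/2 < |y'| < 2r` and `|x'-y'| < r`. [cite: WangYang2026, Lemma A.1 (proof, regions D₁–D₃), pp. 22–23] -/
theorem indicator_mul_inv_norm_sub_le {β γ : ℝ} (hβ : 0 ≤ β) (hγ : 0 ≤ γ)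
    (x' : EuclideanSpace ℝ (Fin 2)) (hx : 0 < ‖x'‖) (w : EuclideanSpace ℝ (Fin 2)) :
    (Ioi (1 : ℝ)).indicator (fun s => ENNReal.ofReal (s ^ β * log (exp 1 + s) ^ γ)⁻¹) ‖w‖ *
        ENNReal.ofReal ‖x' - w‖⁻¹ ≤
      2 * ((Ioi (1 : ℝ)).indicator (fun s => ENNReal.ofReal (s ^ β * log (exp 1 + s) ^ γ)⁻¹) ‖w‖ *
          ENNReal.ofReal (max ‖x'‖ ‖w‖)⁻¹) +
        ENNReal.ofReal (2 ^ β * 2 ^ γ / (‖x'‖ ^ β * log (exp 1 + ‖x'‖) ^ γ)) *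
          (ball x' (3 * ‖x'‖)).indicator (fun w => ENNReal.ofReal ‖x' - w‖⁻¹) w := by
  set r := ‖x'‖ with hr
  set Ψ : ℝ≥0∞ := (Ioi (1 : ℝ)).indicator
    (fun s => ENNReal.ofReal (s ^ β * log (exp 1 + s) ^ γ)⁻¹) ‖w‖ with hΨ
  have hmax : 0 < max r ‖w‖ := lt_max_of_lt_left hx
  by_cases hcase : max r ‖w‖ ≤ 2 * ‖x' - w‖
  · -- far from `x'` relative to the scale: the first term suffices
    have hd : 0 < ‖x' - w‖ := by linarith
    have hinv : ‖x' - w‖⁻¹ ≤ 2 * (max r ‖w‖)⁻¹ := by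
      rw [← div_eq_mul_inv, le_div_iff₀ hmax, inv_mul_le_iff₀ hd]
      linarith
    calc Ψ * ENNReal.ofReal ‖x' - w‖⁻¹ ≤ Ψ * ENNReal.ofReal (2 * (max r ‖w‖)⁻¹) :=
          mul_le_mul' le_rfl (ENNReal.ofReal_le_ofReal hinv)
      _ = 2 * (Ψ * ENNReal.ofReal (max r ‖w‖)⁻¹) := by
          rw [ENNReal.ofReal_mul zero_le_two, ENNReal.ofReal_ofNat]; ring
      _ ≤ _ := le_self_add
  · -- close to `x'`: then `r/2 < |w| < 2r`, `|x' - w| < r`, and `Φ(|w|) ≤ Φ*(r)`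
    rw [not_le] at hcase
    have hwr : r ≤ 2 * ‖w‖ := by
      rcases le_or_gt ‖w‖ r with hle | hgt
      · rw [max_eq_left hle] at hcase
        have := norm_sub_norm_le x' w
        linarith
      · linarith
    have hdist : ‖x' - w‖ < r := by
      rcases le_or_gt ‖w‖ r with hle | hgt
      · rw [max_eq_left hle] at hcase; linarith
      · rw [max_eq_right hgt.le] at hcase
        have : ‖w‖ ≤ ‖x'‖ + ‖x' - w‖ := by
          have := norm_sub_norm_le w x'
          rw [norm_sub_rev] at this
          linarith
        linarith
    have hball : w ∈ ball x' (3 * r) := by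
      rw [mem_ball, dist_eq_norm, norm_sub_rev]; linarith
    have hΨle : Ψ ≤ ENNReal.ofReal (2 ^ β * 2 ^ γ / (r ^ β * log (exp 1 + r) ^ γ)) := by
      rw [hΨ]
      by_cases h1 : ‖w‖ ∈ Ioi (1 : ℝ)
      · rw [indicator_of_mem h1]
        exact ENNReal.ofReal_le_ofReal (inv_rpow_mul_log_rpow_le_of_half_le hβ hγ hx hwr)
      · rw [indicator_of_notMem h1]; exact zero_le
    calc Ψ * ENNReal.ofReal ‖x' - w‖⁻¹
        ≤ ENNReal.ofReal (2 ^ β * 2 ^ γ / (r ^ β * log (exp 1 + r) ^ γ)) *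
            (ball x' (3 * r)).indicator (fun w => ENNReal.ofReal ‖x' - w‖⁻¹) w := by
          rw [indicator_of_mem hball]
          exact mul_le_mul' hΨle le_rfl
      _ ≤ _ := le_add_self

/-! ### The radial term -/

/-- The radial profile of the first term, `y ↦ y Φ(y)/max(r, y)` on `(0, ∞)`, is dominated by
`r⁻¹ · 1_{(1,r]} y/(y^βL(y)^γ) + 1_{(r,∞)} (y^βL(y)^γ)⁻¹`. [folklore] -/
theorem ofReal_mul_indicator_mul_inv_max_le {β γ r : ℝ} {y : ℝ} (hy : y ∈ Ioi (0 : ℝ)) :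
    ENNReal.ofReal y *
        ((Ioi (1 : ℝ)).indicator (fun s => ENNReal.ofReal (s ^ β * log (exp 1 + s) ^ γ)⁻¹) y *
          ENNReal.ofReal (max r y)⁻¹) ≤
      (Ioc 1 r).indicator (fun y => ENNReal.ofReal r⁻¹ *
          ENNReal.ofReal (y / (y ^ β * log (exp 1 + y) ^ γ))) y +
        (Ioi r).indicator (fun y => ENNReal.ofReal (y ^ β * log (exp 1 + y) ^ γ)⁻¹) y := by
  have hy0 : 0 < y := hy
  by_cases h1 : y ∈ Ioi (1 : ℝ)
  · rw [indicator_of_mem h1]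
    rcases le_or_gt y r with hyr | hyr
    · -- `1 < y ≤ r`
      have hIoc : y ∈ Ioc 1 r := ⟨h1, hyr⟩
      have hIoi : y ∉ Ioi r := not_lt.2 hyr
      rw [indicator_of_mem hIoc, indicator_of_notMem hIoi, add_zero, max_eq_left hyr]
      refine le_of_eq ?_
      calc ENNReal.ofReal y * (ENNReal.ofReal (y ^ β * log (exp 1 + y) ^ γ)⁻¹ * ENNReal.ofReal r⁻¹)
          = ENNReal.ofReal r⁻¹ * (ENNReal.ofReal y * ENNReal.ofReal (y ^ β * log (exp 1 + y) ^ γ)⁻¹) := by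
            ring
        _ = ENNReal.ofReal r⁻¹ * ENNReal.ofReal (y / (y ^ β * log (exp 1 + y) ^ γ)) := by
            rw [← ENNReal.ofReal_mul hy0.le, div_eq_mul_inv]
    · -- `y > r`
      have hIoc : y ∉ Ioc 1 r := fun h => (not_lt.2 h.2) hyr
      have hIoi : y ∈ Ioi r := hyr
      rw [indicator_of_notMem hIoc, indicator_of_mem hIoi, zero_add, max_eq_right hyr.le]
      refine le_of_eq ?_
      calc ENNReal.ofReal y * (ENNReal.ofReal (y ^ β * log (exp 1 + y) ^ γ)⁻¹ * ENNReal.ofReal y⁻¹)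
          = ENNReal.ofReal (y ^ β * log (exp 1 + y) ^ γ)⁻¹ * (ENNReal.ofReal y * ENNReal.ofReal y⁻¹) := by
            ring
        _ = ENNReal.ofReal (y ^ β * log (exp 1 + y) ^ γ)⁻¹ := by
            rw [← ENNReal.ofReal_mul hy0.le, mul_inv_cancel₀ hy0.ne', ENNReal.ofReal_one, mul_one]
  · rw [indicator_of_notMem h1, zero_mul, mul_zero]
    exact zero_le

/-- **The radial term**: for `1 < β < 2`, `γ > 0`, `r ≥ 1`,
`∫_{ℝ²} Φ(|w|)/max(r,|w|) dw ≤ 2|B₁| (K₁ + (β-1)⁻¹) r^{1-β} L(r)^{-γ}` with the constant `K₁`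
of `lintegral_Ioc_rpow_div_log_le`. [cite: WangYang2026, Lemma A.2 (proof), p. 24] -/
theorem lintegral_indicator_mul_inv_max_le {β γ r : ℝ} (hβ : 1 < β) (hβ2 : β < 2) (hγ : 0 < γ)
    (hr : 1 ≤ r) :
    ∫⁻ w : EuclideanSpace ℝ (Fin 2),
        (Ioi (1 : ℝ)).indicator (fun s => ENNReal.ofReal (s ^ β * log (exp 1 + s) ^ γ)⁻¹) ‖w‖ *
          ENNReal.ofReal (max r ‖w‖)⁻¹ ≤
      2 * volume (ball (0 : EuclideanSpace ℝ (Fin 2)) 1) *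
        ENNReal.ofReal (((1 + γ / ((2 - β) / 2)) ^ γ * (2 / (2 - β)) + (β - 1)⁻¹) *
          (r ^ (1 - β) / log (exp 1 + r) ^ γ)) := by
  have hr0 : 0 < r := one_pos.trans_le hr
  set K₁ := (1 + γ / ((2 - β) / 2)) ^ γ * (2 / (2 - β)) with hK₁
  have hK₁0 : 0 ≤ K₁ := by
    rw [hK₁]
    have : 0 < 2 - β := by linarith
    positivity
  have hLr : 0 < log (exp 1 + r) := log_exp_one_add_pos hr0.le
  have hLrγ : 0 < log (exp 1 + r) ^ γ := rpow_pos_of_pos hLr γ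
  set F : ℝ → ℝ≥0∞ := fun y =>
    (Ioi (1 : ℝ)).indicator (fun s => ENNReal.ofReal (s ^ β * log (exp 1 + s) ^ γ)⁻¹) y *
      ENNReal.ofReal (max r y)⁻¹ with hF
  have hmeas : Measurable fun s : ℝ => ENNReal.ofReal (s ^ β * log (exp 1 + s) ^ γ)⁻¹ :=
    ENNReal.measurable_ofReal.comp
      ((measurable_id.pow_const β).mul ((measurable_const.add measurable_id).log.pow_const γ)).inv
  have hFm : Measurable F :=
    (hmeas.indicator measurableSet_Ioi).mul
      (ENNReal.measurable_ofReal.comp (measurable_const.max measurable_id).inv)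
  have hrad := lintegral_norm_eq_two_mul F hFm
  simp only [hF] at hrad
  rw [hrad]
  gcongr
  -- the one-dimensional integral
  calc ∫⁻ y in Ioi (0 : ℝ), ENNReal.ofReal y *
          ((Ioi (1 : ℝ)).indicator (fun s => ENNReal.ofReal (s ^ β * log (exp 1 + s) ^ γ)⁻¹) y *
            ENNReal.ofReal (max r y)⁻¹)
      ≤ ∫⁻ y in Ioi (0 : ℝ), ((Ioc 1 r).indicator (fun y => ENNReal.ofReal r⁻¹ *
            ENNReal.ofReal (y / (y ^ β * log (exp 1 + y) ^ γ))) y +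
          (Ioi r).indicator (fun y => ENNReal.ofReal (y ^ β * log (exp 1 + y) ^ γ)⁻¹) y) :=
        setLIntegral_mono' measurableSet_Ioi fun y hy => ofReal_mul_indicator_mul_inv_max_le hy
    _ ≤ ∫⁻ y, ((Ioc 1 r).indicator (fun y => ENNReal.ofReal r⁻¹ *
            ENNReal.ofReal (y / (y ^ β * log (exp 1 + y) ^ γ))) y +
          (Ioi r).indicator (fun y => ENNReal.ofReal (y ^ β * log (exp 1 + y) ^ γ)⁻¹) y) :=
        lintegral_mono' Measure.restrict_le_self le_rfl
    _ = ENNReal.ofReal r⁻¹ * (∫⁻ y in Ioc 1 r, ENNReal.ofReal (y / (y ^ β * log (exp 1 + y) ^ γ))) +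
          ∫⁻ y in Ioi r, ENNReal.ofReal (y ^ β * log (exp 1 + y) ^ γ)⁻¹ := by
        rw [lintegral_add_right _ (hmeas.indicator measurableSet_Ioi),
          lintegral_indicator measurableSet_Ioc, lintegral_indicator measurableSet_Ioi,
          lintegral_const_mul' _ _ ENNReal.ofReal_ne_top]
    _ ≤ ENNReal.ofReal r⁻¹ * ENNReal.ofReal (K₁ * (r ^ (2 - β) / log (exp 1 + r) ^ γ)) +
          ENNReal.ofReal (r ^ (1 - β) / ((β - 1) * log (exp 1 + r) ^ γ)) :=
        add_le_add (mul_le_mul' le_rfl (lintegral_Ioc_rpow_div_log_le hβ2 hγ hr))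
          (lintegral_Ioi_rpow_log_le hβ hγ.le hr0)
    _ = ENNReal.ofReal ((K₁ + (β - 1)⁻¹) * (r ^ (1 - β) / log (exp 1 + r) ^ γ)) := by
        rw [← ENNReal.ofReal_mul (by positivity), ← ENNReal.ofReal_add (by positivity) (by positivity)]
        congr 1
        have hβ1 : β - 1 ≠ 0 := by linarith
        have e1 : r⁻¹ * (K₁ * (r ^ (2 - β) / log (exp 1 + r) ^ γ)) =
            K₁ * (r ^ (1 - β) / log (exp 1 + r) ^ γ) := by
          have : r ^ (2 - β) = r * r ^ (1 - β) := by
            rw [← rpow_one_add' hr0.le (by linarith)]; ring_nf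
          rw [this]; field_simp
        rw [e1]
        field_simp

/-! ### Lemma A.2 -/

/-- **Wang–Yang 2026, Lemma A.2** (the planar logarithmic Riesz-potential estimate, p. 24): for
`1 < β < 2` and `γ > 0` there is `K = K(β, γ)` such that for every `x' ∈ ℝ²` with
`r = |x'| ≥ 2`,
`∫_{|y'|>1} |y'|^{-β}[log(e+|y'|)]^{-γ} |x' - y'|⁻¹ dy' ≤ K r^{1-β} [log(e+r)]^{-γ}`
(as a lower Lebesgue integral over `ℝ²`, the profile being extended by `0` to `|y'| ≤ 1`). Printed:
"`∫_{ℝ²} Φ_{β,γ}(|y'|)/|x'-y'| dy' ≤ C_{β,γ} r^{1-β}[log(e+r)]^{-γ}`, the proof is similar to that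
of Lemma A.1". Here: the pointwise two-term majorant `indicator_mul_inv_norm_sub_le`, the radial
term `lintegral_indicator_mul_inv_max_le` and the disc term `lintegral_ball_inv_norm_le`.
[cite: WangYang2026, Lemma A.2, p. 24] -/
theorem exists_lintegral_planar_logRiesz_le {β γ : ℝ} (hβ : 1 < β) (hβ2 : β < 2) (hγ : 0 < γ) :
    ∃ K : ℝ, 0 ≤ K ∧ ∀ x' : EuclideanSpace ℝ (Fin 2), 2 ≤ ‖x'‖ →
      ∫⁻ w : EuclideanSpace ℝ (Fin 2),
          (Ioi (1 : ℝ)).indicator (fun s => ENNReal.ofReal (s ^ β * log (exp 1 + s) ^ γ)⁻¹) ‖w‖ *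
            ENNReal.ofReal ‖x' - w‖⁻¹ ≤
        ENNReal.ofReal (K * (‖x'‖ ^ (1 - β) / log (exp 1 + ‖x'‖) ^ γ)) := by
  set V : ℝ≥0∞ := volume (ball (0 : EuclideanSpace ℝ (Fin 2)) 1) with hV
  have hVtop : V ≠ ⊤ := measure_ball_lt_top.ne
  set v : ℝ := V.toReal with hv
  have hv0 : 0 ≤ v := ENNReal.toReal_nonneg
  have hVv : V = ENNReal.ofReal v := (ENNReal.ofReal_toReal hVtop).symm
  set K₁ := (1 + γ / ((2 - β) / 2)) ^ γ * (2 / (2 - β)) with hK₁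
  have h2β : 0 < 2 - β := by linarith
  have hK₁0 : 0 ≤ K₁ := by rw [hK₁]; positivity
  set a : ℝ := K₁ + (β - 1)⁻¹ with ha
  have hβ1 : 0 < β - 1 := by linarith
  have ha0 : 0 ≤ a := by rw [ha]; positivity
  set b : ℝ := 3 * (2 ^ β * 2 ^ γ) with hb
  have hb0 : 0 ≤ b := by rw [hb]; positivity
  refine ⟨2 * v * (2 * a + b), by positivity, fun x' hx' => ?_⟩
  set r := ‖x'‖ with hr
  have hr0 : 0 < r := by linarith
  have hr1 : 1 ≤ r := by linarith
  have hLr : 0 < log (exp 1 + r) := log_exp_one_add_pos hr0.le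
  have hLrγ : 0 < log (exp 1 + r) ^ γ := rpow_pos_of_pos hLr γ
  set Q : ℝ := r ^ (1 - β) / log (exp 1 + r) ^ γ with hQ
  have hQ0 : 0 ≤ Q := by rw [hQ]; positivity
  set Φs : ℝ := 2 ^ β * 2 ^ γ / (r ^ β * log (exp 1 + r) ^ γ) with hΦs
  have hΦs0 : 0 ≤ Φs := by rw [hΦs]; positivity
  -- measurability of the disc term
  have hdisc_meas : Measurable fun w : EuclideanSpace ℝ (Fin 2) =>
      ENNReal.ofReal Φs * (ball x' (3 * r)).indicator (fun w => ENNReal.ofReal ‖x' - w‖⁻¹) w :=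
    ((ENNReal.measurable_ofReal.comp (measurable_const.sub measurable_id).norm.inv).indicator
      measurableSet_ball).const_mul _
  -- Step 1: the pointwise majorant, integrated
  have h1 : ∫⁻ w : EuclideanSpace ℝ (Fin 2),
        (Ioi (1 : ℝ)).indicator (fun s => ENNReal.ofReal (s ^ β * log (exp 1 + s) ^ γ)⁻¹) ‖w‖ *
          ENNReal.ofReal ‖x' - w‖⁻¹ ≤
      2 * (∫⁻ w : EuclideanSpace ℝ (Fin 2),
          (Ioi (1 : ℝ)).indicator (fun s => ENNReal.ofReal (s ^ β * log (exp 1 + s) ^ γ)⁻¹) ‖w‖ *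
            ENNReal.ofReal (max r ‖w‖)⁻¹) +
        ENNReal.ofReal Φs * ∫⁻ w in ball x' (3 * r), ENNReal.ofReal ‖x' - w‖⁻¹ := by
    calc _ ≤ ∫⁻ w : EuclideanSpace ℝ (Fin 2),
          (2 * ((Ioi (1 : ℝ)).indicator (fun s => ENNReal.ofReal (s ^ β * log (exp 1 + s) ^ γ)⁻¹) ‖w‖ *
              ENNReal.ofReal (max r ‖w‖)⁻¹) +
            ENNReal.ofReal Φs * (ball x' (3 * r)).indicator (fun w => ENNReal.ofReal ‖x' - w‖⁻¹) w) :=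
          lintegral_mono fun w => indicator_mul_inv_norm_sub_le (by linarith) hγ.le x' hr0 w
      _ = _ := by
          rw [lintegral_add_right _ hdisc_meas, lintegral_const_mul' _ _ ENNReal.ofNat_ne_top,
            lintegral_const_mul' _ _ ENNReal.ofReal_ne_top, lintegral_indicator measurableSet_ball]
  -- Step 2: the radial term
  have h2 := lintegral_indicator_mul_inv_max_le hβ hβ2 hγ hr1
  -- Step 3: the disc term
  have h3 : ENNReal.ofReal Φs * ∫⁻ w in ball x' (3 * r), ENNReal.ofReal ‖x' - w‖⁻¹ ≤
      2 * V * ENNReal.ofReal (b * Q) := by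
    have hdisc : ∫⁻ w in ball x' (3 * r), ENNReal.ofReal ‖x' - w‖⁻¹ ≤ 2 * V * ENNReal.ofReal (3 * r) := by
      rw [lintegral_ball_comp_sub_left_two (fun z => ENNReal.ofReal ‖z‖⁻¹) x' (3 * r)]
      exact lintegral_ball_inv_norm_le (3 * r)
    calc ENNReal.ofReal Φs * ∫⁻ w in ball x' (3 * r), ENNReal.ofReal ‖x' - w‖⁻¹
        ≤ ENNReal.ofReal Φs * (2 * V * ENNReal.ofReal (3 * r)) := mul_le_mul' le_rfl hdisc
      _ = 2 * V * ENNReal.ofReal (Φs * (3 * r)) := by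
          rw [ENNReal.ofReal_mul hΦs0]; ring
      _ = 2 * V * ENNReal.ofReal (b * Q) := by
          congr 2
          rw [hΦs, hb, hQ]
          have : r ^ (1 - β) = r / r ^ β := by
            rw [rpow_sub hr0, rpow_one]
          rw [this]
          field_simp
  -- Step 4: assemble
  calc _ ≤ 2 * (∫⁻ w : EuclideanSpace ℝ (Fin 2),
          (Ioi (1 : ℝ)).indicator (fun s => ENNReal.ofReal (s ^ β * log (exp 1 + s) ^ γ)⁻¹) ‖w‖ *
            ENNReal.ofReal (max r ‖w‖)⁻¹) +
        ENNReal.ofReal Φs * ∫⁻ w in ball x' (3 * r), ENNReal.ofReal ‖x' - w‖⁻¹ := h1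
    _ ≤ 2 * (2 * V * ENNReal.ofReal (a * Q)) + 2 * V * ENNReal.ofReal (b * Q) :=
        add_le_add (mul_le_mul' le_rfl h2) h3
    _ = ENNReal.ofReal (2 * v * (2 * a + b) * Q) := by
        rw [hVv, ← ENNReal.ofReal_ofNat 2, ← ENNReal.ofReal_mul zero_le_two,
          ← ENNReal.ofReal_mul (by positivity), ← ENNReal.ofReal_mul (by positivity),
          ← ENNReal.ofReal_mul (by positivity), ← ENNReal.ofReal_add (by positivity) (by positivity)]
        congr 1
        ring
    _ = _ := by rw [hQ]

end Literature.Analysis.FluidPDE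

end
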